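/-
Copyright (c) 2026 the pub-hodgecm-mathlib formalisation cell (harness21).  Prover seat hodgecm-mathlib-K2E3-p06 (g4), Track B «K2-LIT», engine E3, unit U4 «Keys»; deal (D61)
LINE LEAD of the open leaf (U4f-χ₁-ram-one), design D-I v2, plan step Z2A-3b «THE DEPTH-ZERO IWAHORI CHARACTER `θ(g) = χ₁(g₀₀)` ON `U(Φ₃)(L⁺_v)`» — the CM dress of ★ Z2A-1 and
★ Z2A-3a along the one-place model `eA`; 2026-09-04.  KERNEL module: THEOREMS ONLY (no definition, no named fact, no `sorry`, no instance, no notation).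
-/
import Summits.HodgeConjecture.HodgeConjecture.Theorems.K2E3DepthZeroIwahoriCharacter        -- ★ Z2A-1 p858258 (this seat): `v_mul_apply_zero_zero_sub_lt_one`, `apply_zero_zero_ne_zero_of_mem` (place model)
import Summits.HodgeConjecture.HodgeConjecture.Theorems.K2E3LowerUnipotentBorelIwahori        -- ★ Z2A-3a p858303 (this seat): `coe_apply_zero_zero_eq_one_of_mem_map` (place model `N̄`)
import Summits.HodgeConjecture.HodgeConjecture.Theorems.K2E3KeysThmTwoContractingRamified      -- ★ p857330 (this seat): brings the (G3)-EXPLICIT frame (`Gqs`, `eA`∕`heA`, levels `K₀ K₁ I`), ★ `localNonsplitEquiv_apply_apply`, ★ CM torus∕Borel API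
import HarnessLib

/-!
# K2 ∕ E3 «EllipticInputs», unit U4 «Keys» — (U4f-χ₁-ram-one) step Z2A-3b: THE DEPTH-ZERO CHARACTER `θ(g) = χ₁(g₀₀)` OF THE IWAHORI OF `U(Φ₃)(L⁺_v)`, CM DRESS
# «for `χ₁ : (L ⊗ L⁺_v)ˣ → ℂˣ` trivial on principal units, `g ↦ χ₁(g₀₀)` is multiplicative on `I = eA⁻¹(K₀ ⊓ K₁)`, trivial on `N̄`, and reads `χ₁(torusEntry 0 (proj p))` on `P`»
# [MoyPrasad1996 §3; Roche1998 §3; BruhatTits1972 (4.4.4)]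

Cell hodgecm-mathlib (D-0151), FLOOR 0, Track B «K2-LIT», engine E3, crux item H413 = stmt-HodgeConjecture-24833 (route `HCCMUnconditional`, no route verbs); target BY NAME
the OPEN leaf `…K2E3EllipticInputs.U4Keys.sig_K2E3KeysThmTwoContractingRamifiedCharOne` (U4Keys ED. 7), design D-I v2, plan step Z2A (Branch A), CM dress.  Author K2E3-p06 (g4),
line lead (D61).  `--supports stmt-HodgeConjecture-24833 --as helper`; THEOREMS ONLY.  NOT THE PAYER.

THE POINT.  ★ (V2b) `K2E3TypeVectorOfSubrepFactored.exists_typeVector_of_mem_of_factored` wants a function `θ : G → ℂ` on `G = U(Φ₃)(L⁺_v)` multiplicative on the type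
group `B = I` (`hθmul`), equal to the inducing character on `I ∩ P` (`hθH`) and trivial on `C = I ∩ N̄` (`hθC`).  At DEPTH ZERO the function is
`θ(g) = χ₁(g₀₀)` — written WITHOUT a definition as `if h : IsUnit g₀₀ then χ₁(h.unit) else 0` — and this file proves its three properties in the (G3)-EXPLICIT frame
`(w hw eA heA ϖ hϖ g₁ hg₁ K₀ K₁ I hK₀ hK₁ hI)` of ★ Road II by transport along the one-place model `eA` (entries `(eA g)ᵢⱼ = gᵢⱼ(w)`, ★ `localNonsplitEquiv_apply_apply`;
one place over a non-split `v`, ★ `PlacesOver.eq_of_smul_eq`): multiplicativity from ★ Z2A-1 (`|(jj′)₀₀ − j₀₀j′₀₀|_w < 1` on the place Iwahori), triviality on `N̄` from ★ Z2A-3a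
(`n̄₀₀ = 1`), and on `P` the `(0,0)` entry IS `torusEntry 0 (proj p)` (★ `coe_torusEntry_proj_borelTriple`).  Also: `eA` maps the long Weyl element `w₀` (matrix `Φ₃`) to
★ `weylLongU` and `N`, `N̄ = N.map (conj w₀)` to their place models (§3) — the letters every later CM step (Z2A-3c) transports through.
* §1 `coe_eA_apply` (entries along `eA`), `isUnit_of_apply_ne_zero` (units of `L ⊗ L⁺_v` at a non-split place), `map_mem_inf_of_mem`, **`isUnit_apply_zero_zero_of_mem`** (`j ∈ I ⟹ j₀₀` a unit).
* §2 `v_mul_inv_sub_one_lt_one`, **`chi_unit_apply_zero_zero_mul`**, **`theta_mul`** (`θ(jj′) = θ(j)θ(j′)` on `I`, `χ₁` of depth zero; `θ` needs `open Classical` for its `dite`).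
* §3 (letters `t`, `ht : t = cmBorelTriple L 3 v` of ★ Road II; `w₀` with matrix `Φ₃`) `map_weyl_eq_weylLongU`, `map_mem_unipotentU_of_mem`, `map_mem_map_of_mem_map`, `apply_zero_zero_eq_one_of_mem_map`, **`theta_eq_one_of_mem_map`** (`θ = 1` on `N̄`).
* §4 `chi_torusEntry_proj_eq` (`χ₁(torusEntry 0 (proj p)) = χ₁(unit p₀₀)` for `p ∈ P`), `theta_eq_chi_torusEntry_proj` (the `χ₁`-part of `hθH`).
HONEST LABEL: HC_CM is proved only modulo the 7 printed citations (2 remaining named inputs: hLiu418 = stmt-HodgeConjecture-24832, h413 = stmt-HodgeConjecture-24833)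
until rung 0 closes; count-neutral — this file does NOT pay the leaf; no printed citation is discharged.

## References
* [MoyPrasad1996] A. Moy, G. Prasad, *Jacquet functors and unrefined minimal K-types*, Comment. Math. Helv. 71 (1996), §3 (depth-zero types `(I, χ̄)`).
* [Roche1998] A. Roche, *Types and Hecke algebras for principal series representations of split reductive p-adic groups*, Ann. Sci. ÉNS (4) 31 (1998), §3 (the character `χ̃` of `J_χ`).
* [BruhatTits1972] F. Bruhat, J. Tits, Publ. Math. IHÉS 41 (1972), (4.4.4) (the Iwahori subgroup of a rank-one group).
* [PlatonovRapinchuk1994] V. Platonov, A. Rapinchuk, *Algebraic Groups and Number Theory* (1994), §5.1 (`G(L ⊗ L⁺_v) = G(L_w)` at a non-split place).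
* [Rogawski1990] J. Rogawski, Ann. of Math. Stud. 123 (1990), §1.10 p. 9; §12.1 p. 171 (the torus character `χ = (χ₁, χ₂)`).
-/

set_option autoImplicit false
-- the mandated namespace has the single-problem summit's repeated segment (`HodgeConjecture.HodgeConjecture`)
set_option linter.dupNamespace false

noncomputable section

open NumberField IsDedekindDomain
open scoped Matrix MatrixGroups WithZero Valued
open Literature.NumberTheory Literature.NumberTheory.Automorphic Literature.NumberTheory.Automorphic.UnitaryGroup
open Literature.NumberTheory.Rogawski1990

namespace Summit.HodgeConjecture.HodgeConjecture.Cruxes.H413.K2E3DepthZeroIwahoriCharacterCM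

open Summit.HodgeConjecture.HodgeConjecture.Cruxes.H413

variable (L : Type) [Field L] [NumberField L] [IsCMField L] (v : HeightOneSpectrum (𝓞 ↥(maximalRealSubfield L)))
  (w : PlacesOver L v) (hw : IsCMField.complexConj L • w.1 = w.1)
  (eA : Gqs L v ≃ₜ* ↥(unitaryGroupOfForm (galAdicCompletionMap (L := L) (IsCMField.complexConj L) hw) ((StdForm.antidiagonal 3).over (w.1.adicCompletion L))))
  (heA : ∀ g : Gqs L v,
    ((eA g : ↥(unitaryGroupOfForm (galAdicCompletionMap (L := L) (IsCMField.complexConj L) hw) ((StdForm.antidiagonal 3).over (w.1.adicCompletion L)))) :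
        GL (Fin 3) (w.1.adicCompletion L)) =
      ((localNonsplitEquiv (IsCMField.complexConj L) (qsForm L) (IsCMField.complexConj_ne_one L) w hw g :
        ↥(unitaryGroupOfForm (galAdicCompletionMap (L := L) (IsCMField.complexConj L) hw) (placeForm (qsForm L) w.1))) : GL (Fin 3) (w.1.adicCompletion L)))
  {ϖ : w.1.adicCompletion L} (hϖ : Valued.v ϖ = WithZero.exp (-1 : ℤ))
  (g₁ : GL (Fin 3) (w.1.adicCompletion L)) (hg₁ : (g₁ : Matrix (Fin 3) (Fin 3) (w.1.adicCompletion L)) = Matrix.diagonal ![(1 : w.1.adicCompletion L), 1, ϖ])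
  (K0 K1 I : Subgroup (Gqs L v))
  (hK0 : K0 = ((glInt 3 (w.1.adicCompletion L)).subgroupOf
    (unitaryGroupOfForm (galAdicCompletionMap (L := L) (IsCMField.complexConj L) hw) ((StdForm.antidiagonal 3).over (w.1.adicCompletion L)))).comap
      eA.toMulEquiv.toMonoidHom)
  (hK1 : K1 = (((glInt 3 (w.1.adicCompletion L)).map (MulAut.conj g₁).toMonoidHom).subgroupOf
    (unitaryGroupOfForm (galAdicCompletionMap (L := L) (IsCMField.complexConj L) hw) ((StdForm.antidiagonal 3).over (w.1.adicCompletion L)))).comap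
      eA.toMulEquiv.toMonoidHom)
  (hI : I = K0 ⊓ K1)

/-! ## §1 Entries along `eA`; units of `L ⊗ L⁺_v`; the `(0,0)` entry on `I` -/

include heA in
/-- **`(eA g)ᵢⱼ = gᵢⱼ(w)`** (★ `localNonsplitEquiv_apply_apply` read through `heA`). [cite: PlatonovRapinchuk1994, §5.1] -/
theorem coe_eA_apply (g : Gqs L v) (i j : Fin 3) :
    (((eA g : ↥(unitaryGroupOfForm (galAdicCompletionMap (L := L) (IsCMField.complexConj L) hw) ((StdForm.antidiagonal 3).over (w.1.adicCompletion L)))) :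
        GL (Fin 3) (w.1.adicCompletion L)) : Matrix (Fin 3) (Fin 3) (w.1.adicCompletion L)) i j =
      ((g.val : GL (Fin 3) (LocalRing L v)) : Matrix (Fin 3) (Fin 3) (LocalRing L v)) i j w := by
  rw [heA]; exact localNonsplitEquiv_apply_apply L v w hw g i j

include hw in
/-- At a NON-SPLIT `v` (one place `w` over `v`), an element of `L ⊗ L⁺_v = ∏_{w′ ∣ v} L_{w′}` with non-zero `w`-component is a unit. [cite: PlatonovRapinchuk1994, §5.1] -/
theorem isUnit_of_apply_ne_zero (x : LocalRing L v) (hx : x w ≠ 0) : IsUnit x := by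
  refine isUnit_iff_exists_inv.2 ⟨fun w' => (x w')⁻¹, funext fun w' => ?_⟩
  obtain rfl := PlacesOver.eq_of_smul_eq (IsCMField.complexConj L) (IsCMField.complexConj_ne_one L) w hw w'
  rw [Pi.mul_apply, Pi.one_apply]; exact mul_inv_cancel₀ hx

include hK0 hK1 hI in
/-- `j ∈ I = K₀ ⊓ K₁` ⟹ `eA j` lies in the place-model Iwahori `(GL₃(𝒪) ∩ U) ⊓ (g₁ GL₃(𝒪) g₁⁻¹ ∩ U)`. [cite: BruhatTits1972, (4.4.4)] -/
theorem map_mem_inf_of_mem {j : Gqs L v} (hj : j ∈ I) :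
    eA j ∈ (glInt 3 (w.1.adicCompletion L)).subgroupOf
        (unitaryGroupOfForm (galAdicCompletionMap (L := L) (IsCMField.complexConj L) hw) ((StdForm.antidiagonal 3).over (w.1.adicCompletion L))) ⊓
      ((glInt 3 (w.1.adicCompletion L)).map (MulAut.conj g₁).toMonoidHom).subgroupOf
        (unitaryGroupOfForm (galAdicCompletionMap (L := L) (IsCMField.complexConj L) hw) ((StdForm.antidiagonal 3).over (w.1.adicCompletion L))) := by
  subst hI hK0 hK1
  exact Subgroup.mem_inf.2 ⟨(Subgroup.mem_inf.1 hj).1, (Subgroup.mem_inf.1 hj).2⟩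

include heA hϖ hg₁ hK0 hK1 hI in
/-- **For `j ∈ I` the entry `j₀₀ ∈ L ⊗ L⁺_v` is a unit** (its `w`-component `(eA j)₀₀` is a `w`-adic unit, ★ Z2A-1 `apply_zero_zero_ne_zero_of_mem`). [cite: BruhatTits1972, (4.4.4)] -/
theorem isUnit_apply_zero_zero_of_mem {j : Gqs L v} (hj : j ∈ I) :
    IsUnit (((j.val : GL (Fin 3) (LocalRing L v)) : Matrix (Fin 3) (Fin 3) (LocalRing L v)) 0 0) := by
  refine isUnit_of_apply_ne_zero L v w hw _ ?_
  rw [← coe_eA_apply L v w hw eA heA j 0 0]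
  exact K2E3DepthZeroIwahoriCharacter.apply_zero_zero_ne_zero_of_mem (galAdicCompletionMap (L := L) (IsCMField.complexConj L) hw) rfl
    (fun x => valued_galAdicCompletionMap (L := L) (IsCMField.complexConj L) hw x) hϖ g₁ hg₁ (map_mem_inf_of_mem L v w hw eA g₁ K0 K1 I hK0 hK1 hI hj)

/-! ## §2 Multiplicativity of `θ(g) = χ₁(g₀₀)` on `I` at depth zero -/

/-- `|a| = |b| = 1`, `|c − ab| < 1` ⟹ `|c∕(ab) − 1| < 1` (the quotient is a principal unit). [cite: MoyPrasad1996, §3] -/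
theorem v_mul_inv_sub_one_lt_one {K : Type*} [Field K] [Valued K ℤᵐ⁰] {a b c : K}
    (ha : Valued.v a = 1) (hb : Valued.v b = 1) (hc : Valued.v (c - a * b) < 1) (ha0 : a ≠ 0) (hb0 : b ≠ 0) :
    Valued.v (c * (a * b)⁻¹ - 1) < 1 := by
  rw [show c * (a * b)⁻¹ - 1 = (c - a * b) * (a * b)⁻¹ by rw [sub_mul, mul_inv_cancel₀ (mul_ne_zero ha0 hb0)],
    map_mul, map_inv₀, map_mul, ha, hb, mul_one, inv_one, mul_one]
  exact hc


include heA hϖ hg₁ hK0 hK1 hI in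
/-- **`χ₁((jj′)₀₀) = χ₁(j₀₀)·χ₁(j′₀₀)` for `j, j′ ∈ I`** when `χ₁` is trivial on the principal units `{u : |u_w′ − 1| < 1 ∀ w′}` of `L ⊗ L⁺_v`: the quotient
`u = (jj′)₀₀ ∕ (j₀₀ j′₀₀)` is a principal unit — at the one place `w`, `|(jj′)₀₀ − j₀₀j′₀₀|_w < 1` and `|j₀₀|_w = |j′₀₀|_w = 1` (★ Z2A-1 on the place Iwahori, read through `eA`).
[cite: MoyPrasad1996, §3] [cite: Roche1998, §3] -/
theorem chi_unit_apply_zero_zero_mul (χ₁ : (LocalRing L v)ˣ →* ℂˣ)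
    (hdepth : ∀ u : (LocalRing L v)ˣ, (∀ w' : PlacesOver L v, Valued.v (((u : LocalRing L v) w') - 1) < 1) → χ₁ u = 1)
    {j j' : Gqs L v} (hj : j ∈ I) (hj' : j' ∈ I)
    (h0 : IsUnit ((((j * j').val : GL (Fin 3) (LocalRing L v)) : Matrix (Fin 3) (Fin 3) (LocalRing L v)) 0 0))
    (h1 : IsUnit (((j.val : GL (Fin 3) (LocalRing L v)) : Matrix (Fin 3) (Fin 3) (LocalRing L v)) 0 0))
    (h2 : IsUnit (((j'.val : GL (Fin 3) (LocalRing L v)) : Matrix (Fin 3) (Fin 3) (LocalRing L v)) 0 0)) :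
    χ₁ h0.unit = χ₁ h1.unit * χ₁ h2.unit := by
  have hvσ : ∀ x, Valued.v (galAdicCompletionMap (L := L) (IsCMField.complexConj L) hw x) = Valued.v x :=
    fun x => valued_galAdicCompletionMap (L := L) (IsCMField.complexConj L) hw x
  have hjI := map_mem_inf_of_mem L v w hw eA g₁ K0 K1 I hK0 hK1 hI hj
  have hj'I := map_mem_inf_of_mem L v w hw eA g₁ K0 K1 I hK0 hK1 hI hj'
  -- the three entries at the place `w`
  have ha : Valued.v (((j.val : GL (Fin 3) (LocalRing L v)) : Matrix (Fin 3) (Fin 3) (LocalRing L v)) 0 0 w) = 1 := by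
    rw [← coe_eA_apply L v w hw eA heA j 0 0]
    exact K2E3IwahoriFactorisationThree.v_apply_zero_zero_eq_one_of_mem_inf _ rfl hvσ hϖ g₁ hg₁ hjI
  have hb : Valued.v (((j'.val : GL (Fin 3) (LocalRing L v)) : Matrix (Fin 3) (Fin 3) (LocalRing L v)) 0 0 w) = 1 := by
    rw [← coe_eA_apply L v w hw eA heA j' 0 0]
    exact K2E3IwahoriFactorisationThree.v_apply_zero_zero_eq_one_of_mem_inf _ rfl hvσ hϖ g₁ hg₁ hj'I
  have hc : Valued.v ((((j * j').val : GL (Fin 3) (LocalRing L v)) : Matrix (Fin 3) (Fin 3) (LocalRing L v)) 0 0 w -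
      ((j.val : GL (Fin 3) (LocalRing L v)) : Matrix (Fin 3) (Fin 3) (LocalRing L v)) 0 0 w *
        ((j'.val : GL (Fin 3) (LocalRing L v)) : Matrix (Fin 3) (Fin 3) (LocalRing L v)) 0 0 w) < 1 := by
    rw [← coe_eA_apply L v w hw eA heA (j * j') 0 0, ← coe_eA_apply L v w hw eA heA j 0 0, ← coe_eA_apply L v w hw eA heA j' 0 0, map_mul]
    exact K2E3DepthZeroIwahoriCharacter.v_mul_apply_zero_zero_sub_lt_one _ rfl hvσ hϖ g₁ hg₁ hjI hj'I
  have ha0 : ((j.val : GL (Fin 3) (LocalRing L v)) : Matrix (Fin 3) (Fin 3) (LocalRing L v)) 0 0 w ≠ 0 := fun h => by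
    rw [h, map_zero] at ha; exact zero_ne_one ha
  have hb0 : ((j'.val : GL (Fin 3) (LocalRing L v)) : Matrix (Fin 3) (Fin 3) (LocalRing L v)) 0 0 w ≠ 0 := fun h => by
    rw [h, map_zero] at hb; exact zero_ne_one hb
  -- the quotient is a principal unit
  have hu : ∀ w' : PlacesOver L v, Valued.v ((((h0.unit * (h1.unit * h2.unit)⁻¹ : (LocalRing L v)ˣ)) : LocalRing L v) w' - 1) < 1 := by
    intro w'
    obtain rfl := (PlacesOver.eq_of_smul_eq (IsCMField.complexConj L) (IsCMField.complexConj_ne_one L) w hw w').symm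
    rw [Units.val_mul, Units.val_inv_eq_inv_val, Units.val_mul, IsUnit.unit_spec, IsUnit.unit_spec, IsUnit.unit_spec, Pi.mul_apply, Pi.inv_apply,
      Pi.mul_apply]
    exact v_mul_inv_sub_one_lt_one ha hb hc ha0 hb0
  have h := hdepth _ hu
  rw [map_mul, map_inv, mul_inv_eq_one] at h
  rw [h, map_mul]

open Classical in
include heA hϖ hg₁ hK0 hK1 hI in
/-- **`θ(jj′) = θ(j)·θ(j′)` on `I`** for `θ(g) := if h : IsUnit g₀₀ then χ₁(h.unit) else 0` and `χ₁` of depth zero — the letter `hθmul` of ★ (V2b) at `B = I`.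
[cite: MoyPrasad1996, §3] [cite: Roche1998, §3] -/
theorem theta_mul (χ₁ : (LocalRing L v)ˣ →* ℂˣ)
    (hdepth : ∀ u : (LocalRing L v)ˣ, (∀ w' : PlacesOver L v, Valued.v (((u : LocalRing L v) w') - 1) < 1) → χ₁ u = 1)
    {j j' : Gqs L v} (hj : j ∈ I) (hj' : j' ∈ I) :
    (if h : IsUnit ((((j * j').val : GL (Fin 3) (LocalRing L v)) : Matrix (Fin 3) (Fin 3) (LocalRing L v)) 0 0) then ((χ₁ h.unit : ℂˣ) : ℂ) else 0) =
      (if h : IsUnit (((j.val : GL (Fin 3) (LocalRing L v)) : Matrix (Fin 3) (Fin 3) (LocalRing L v)) 0 0) then ((χ₁ h.unit : ℂˣ) : ℂ) else 0) *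
        (if h : IsUnit (((j'.val : GL (Fin 3) (LocalRing L v)) : Matrix (Fin 3) (Fin 3) (LocalRing L v)) 0 0) then ((χ₁ h.unit : ℂˣ) : ℂ) else 0) := by
  have h0 := isUnit_apply_zero_zero_of_mem L v w hw eA heA hϖ g₁ hg₁ K0 K1 I hK0 hK1 hI (Subgroup.mul_mem _ hj hj')
  have h1 := isUnit_apply_zero_zero_of_mem L v w hw eA heA hϖ g₁ hg₁ K0 K1 I hK0 hK1 hI hj
  have h2 := isUnit_apply_zero_zero_of_mem L v w hw eA heA hϖ g₁ hg₁ K0 K1 I hK0 hK1 hI hj'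
  rw [dif_pos h0, dif_pos h1, dif_pos h2, ← Units.val_mul,
    chi_unit_apply_zero_zero_mul L v w hw eA heA hϖ g₁ hg₁ K0 K1 I hK0 hK1 hI χ₁ hdepth hj hj' h0 h1 h2]

/-! ## §3 `eA` on the long Weyl element, on `N` and on `N̄`; `θ = 1` on `N̄` -/

include heA in
/-- **`eA(w₀) = w`**: the element of `U(Φ₃)(L⁺_v)` with matrix `Φ₃` (the `w₀` of ★ V1) goes to ★ `weylLongU` of the place model (entries of `Φ₃` over `∏ L_{w′}` read at `w`,
★ `StdForm.over_map`). [cite: Rogawski1990, §1.10 p. 9] -/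
theorem map_weyl_eq_weylLongU (w₀ : Gqs L v) (hw₀ : Units.val (w₀.val : GL (Fin 3) (LocalRing L v)) = cmLocalForm L 3 v) :
    eA w₀ = weylLongU (galAdicCompletionMap (L := L) (IsCMField.complexConj L) hw) (rfl : (StdForm.antidiagonal 3).over (w.1.adicCompletion L) = _) := by
  apply Subtype.ext
  apply Units.ext
  rw [coe_coe_weylLongU]
  refine Matrix.ext fun i j => ?_
  rw [coe_eA_apply L v w hw eA heA w₀ i j]
  have e1 : ((w₀.val : GL (Fin 3) (LocalRing L v)) : Matrix (Fin 3) (Fin 3) (LocalRing L v)) i j w = cmLocalForm L 3 v i j w := by rw [← hw₀]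
  rw [e1, cmLocalForm_eq_over]
  have h := congr_fun (congr_fun ((StdForm.antidiagonal 3).over_map (Pi.evalRingHom (fun w' : PlacesOver L v => w'.1.adicCompletion L) w)) i) j
  rw [Matrix.map_apply, Pi.evalRingHom_apply] at h
  exact h

include heA in
/-- `eA` maps `N(L⁺_v)` (upper unitriangular; `t = cmBorelTriple`, the letter `ht` of ★ Road II) into the place-model `N`. [cite: Rogawski1990, §1.10 p. 9] -/
theorem map_mem_unipotentU_of_mem (t : ParabolicTriple (Gqs L v)) (ht : t = cmBorelTriple L 3 v) {n : Gqs L v} (hn : n ∈ t.N) :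
    eA n ∈ unipotentU (galAdicCompletionMap (L := L) (IsCMField.complexConj L) hw) ((StdForm.antidiagonal 3).over (w.1.adicCompletion L)) := by
  subst ht
  obtain ⟨htri, hdiag⟩ := (mem_unipotentU_iff _).1 (show n ∈ unipotentU (conjLocal L (IsCMField.complexConj L) v) (cmLocalForm L 3 v) from hn)
  rw [mem_unipotentU_iff]
  refine ⟨fun i j hij => ?_, fun i => ?_⟩
  · rw [coe_eA_apply L v w hw eA heA n i j]
    have e : ((n.val : GL (Fin 3) (LocalRing L v)) : Matrix (Fin 3) (Fin 3) (LocalRing L v)) i j = 0 := htri hij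
    rw [e, Pi.zero_apply]
  · rw [coe_eA_apply L v w hw eA heA n i i]
    have e : ((n.val : GL (Fin 3) (LocalRing L v)) : Matrix (Fin 3) (Fin 3) (LocalRing L v)) i i = 1 := hdiag i
    rw [e, Pi.one_apply]

include heA in
/-- `eA` maps `N̄ = N.map (conj w₀)` into the place-model `N̄ = N.map (conj w)` (§3 `map_weyl_eq_weylLongU`, `map_mem_unipotentU_of_mem`). [cite: Rogawski1990, §1.10 p. 9] -/
theorem map_mem_map_of_mem_map (t : ParabolicTriple (Gqs L v)) (ht : t = cmBorelTriple L 3 v)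
    (w₀ : Gqs L v) (hw₀ : Units.val (w₀.val : GL (Fin 3) (LocalRing L v)) = cmLocalForm L 3 v)
    {nb : Gqs L v} (hnb : nb ∈ (t.N).map (MulAut.conj w₀).toMonoidHom) :
    eA nb ∈ ((borelTriple (galAdicCompletionMap (L := L) (IsCMField.complexConj L) hw) ((StdForm.antidiagonal 3).over (w.1.adicCompletion L)) rfl).N).map
      (MulAut.conj (weylLongU (galAdicCompletionMap (L := L) (IsCMField.complexConj L) hw)
        (rfl : (StdForm.antidiagonal 3).over (w.1.adicCompletion L) = _))).toMonoidHom := by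
  obtain ⟨n, hn, rfl⟩ := Subgroup.mem_map.1 hnb
  refine Subgroup.mem_map.2 ⟨eA n, map_mem_unipotentU_of_mem L v w hw eA heA t ht hn, ?_⟩
  rw [MulEquiv.coe_toMonoidHom, MulAut.conj_apply, MulEquiv.coe_toMonoidHom, MulAut.conj_apply, map_mul, map_mul, map_inv,
    map_weyl_eq_weylLongU L v w hw eA heA w₀ hw₀]

include hw heA in
/-- **`n̄₀₀ = 1` for `n̄ ∈ N̄(L⁺_v)`** (at the one place `w`: ★ Z2A-3a `coe_apply_zero_zero_eq_one_of_mem_map`). [cite: Rogawski1990, §1.10 p. 9] -/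
theorem apply_zero_zero_eq_one_of_mem_map (t : ParabolicTriple (Gqs L v)) (ht : t = cmBorelTriple L 3 v)
    (w₀ : Gqs L v) (hw₀ : Units.val (w₀.val : GL (Fin 3) (LocalRing L v)) = cmLocalForm L 3 v)
    {nb : Gqs L v} (hnb : nb ∈ (t.N).map (MulAut.conj w₀).toMonoidHom) :
    ((nb.val : GL (Fin 3) (LocalRing L v)) : Matrix (Fin 3) (Fin 3) (LocalRing L v)) 0 0 = 1 := by
  rw [LocalRing.eq_iff_apply_eq (IsCMField.complexConj L) (IsCMField.complexConj_ne_one L) w hw, ← coe_eA_apply L v w hw eA heA nb 0 0, Pi.one_apply]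
  exact K2E3LowerUnipotentBorelIwahori.coe_apply_zero_zero_eq_one_of_mem_map _ rfl
    (galAdicCompletionMap_galAdicCompletionMap_of_smul_eq (IsCMField.complexConj L) w (IsCMField.complexConj_ne_one L) hw)
    (map_mem_map_of_mem_map L v w hw eA heA t ht w₀ hw₀ hnb)

open Classical in
include hw heA in
/-- **`θ = 1` on `N̄`** for `θ(g) := if h : IsUnit g₀₀ then χ₁(h.unit) else 0` — the letter `hθC` of ★ (V2b) at `C = I ∩ N̄` (and the value `f′(n̄) = f′(1)` on `N̄ ∩ I` in
step (5)). [cite: MoyPrasad1996, §3] [cite: BruhatTits1972, (4.4.4)] -/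
theorem theta_eq_one_of_mem_map (χ₁ : (LocalRing L v)ˣ →* ℂˣ) (t : ParabolicTriple (Gqs L v)) (ht : t = cmBorelTriple L 3 v)
    (w₀ : Gqs L v) (hw₀ : Units.val (w₀.val : GL (Fin 3) (LocalRing L v)) = cmLocalForm L 3 v)
    {nb : Gqs L v} (hnb : nb ∈ (t.N).map (MulAut.conj w₀).toMonoidHom) :
    (if h : IsUnit (((nb.val : GL (Fin 3) (LocalRing L v)) : Matrix (Fin 3) (Fin 3) (LocalRing L v)) 0 0) then ((χ₁ h.unit : ℂˣ) : ℂ) else 0) = 1 := by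
  have h00 := apply_zero_zero_eq_one_of_mem_map L v w hw eA heA t ht w₀ hw₀ hnb
  have h1 : IsUnit (((nb.val : GL (Fin 3) (LocalRing L v)) : Matrix (Fin 3) (Fin 3) (LocalRing L v)) 0 0) := by rw [h00]; exact isUnit_one
  have hu : h1.unit = 1 := Units.ext (by rw [IsUnit.unit_spec, h00, Units.val_one])
  rw [dif_pos h1, hu, map_one, Units.val_one]

/-! ## §4 On `P`: the `(0,0)` entry is `torusEntry 0 (proj p)` -/

/-- **`χ₁(torusEntry 0 (proj p)) = χ₁(unit p₀₀)`** for `p ∈ P(L⁺_v)` — the Levi projection reads off the diagonal (★ `coe_torusEntry_proj_borelTriple`), so the `χ₁`-factor of the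
inducing character `χ = (χ₁, χ₂)` (★ `torusCharPair_apply`) at `p` is `θ(p)`. [cite: Rogawski1990, §12.1 p. 171] [cite: Rogawski1990, §1.10 p. 9] -/
theorem chi_torusEntry_proj_eq (χ₁ : (LocalRing L v)ˣ →* ℂˣ) (p : ↥(cmBorelTriple L 3 v).P)
    (h : IsUnit ((((p : ↥(cmBorelTriple L 3 v).P) : ↥(unitaryGroupOfForm (conjLocal L (IsCMField.complexConj L) v) (cmLocalForm L 3 v))) :
      GL (Fin 3) (LocalRing L v)).val 0 0)) :
    χ₁ (torusEntry (conjLocal L (IsCMField.complexConj L) v) (cmLocalForm L 3 v) 0 ((cmBorelTriple L 3 v).proj p)) = χ₁ h.unit := by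
  congr 1
  exact Units.ext (by rw [coe_torusEntry_proj_borelTriple, IsUnit.unit_spec])

open Classical in
/-- **`θ(p) = χ₁(torusEntry 0 (proj p))` on `P`** for `θ(g) := if h : IsUnit g₀₀ then χ₁(h.unit) else 0` whenever `p₀₀` is a unit (e.g. `p ∈ P ∩ I`, §1) — the `χ₁`-part of the
letter `hθH` of ★ (V2b) (the `χ₂ = 1` and `δ^{1∕2} = 1`-on-compacta factors are supplied at assembly, ★ `rootDeltaChar_eq_one_of_mem_of_isClosed_of_isCompact`).
[cite: Rogawski1990, §12.1 p. 171] -/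
theorem theta_eq_chi_torusEntry_proj (χ₁ : (LocalRing L v)ˣ →* ℂˣ) (p : ↥(cmBorelTriple L 3 v).P)
    (h : IsUnit ((((p : ↥(cmBorelTriple L 3 v).P) : ↥(unitaryGroupOfForm (conjLocal L (IsCMField.complexConj L) v) (cmLocalForm L 3 v))) :
      GL (Fin 3) (LocalRing L v)).val 0 0)) :
    (if h' : IsUnit ((((p : ↥(cmBorelTriple L 3 v).P) : ↥(unitaryGroupOfForm (conjLocal L (IsCMField.complexConj L) v) (cmLocalForm L 3 v))) :
        GL (Fin 3) (LocalRing L v)).val 0 0) then ((χ₁ h'.unit : ℂˣ) : ℂ) else 0) =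
      ((χ₁ (torusEntry (conjLocal L (IsCMField.complexConj L) v) (cmLocalForm L 3 v) 0 ((cmBorelTriple L 3 v).proj p)) : ℂˣ) : ℂ) := by
  rw [dif_pos h, chi_torusEntry_proj_eq L v χ₁ p h]

end Summit.HodgeConjecture.HodgeConjecture.Cruxes.H413.K2E3DepthZeroIwahoriCharacterCM

end
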